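import Literature.NumberTheory.Automorphic.BrandtAtkinLehnerSign
import Literature.NumberTheory.Automorphic.BrandtXiCanonical
import HarnessLib

/-!
# The Atkin–Lehner signs read off the Brandt module do not depend on the setup

Topic `NumberTheory/Automorphic`; theorems only (no definition, no named fact, no instance).
For a Brandt setup `S` of type `(N⁺, N⁻)`, a prime `q ∣ N⁻` and an eigenvalue system `λ`, the
involution `T(q)` acts on the eigen-lattice `L_S(λ)` by a sign `ε` as soon as `L_S(λ)` is a line
(`Brandt.XiSetup.exists_atkinLehnerSign`, `BrandtAtkinLehnerSign.lean`). Since the Brandt data of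
any two setups `S, S'` of the same type correspond under a bijection of class sets
(`Brandt.XiSetup.exists_classSetEquiv`, `BrandtXiCanonical.lean`), the eigen-lattices correspond
(`v ↦ v ∘ e⁻¹`) equivariantly for every `T(n)`, and the scalar by which `T(q)` acts is the same:

* `Brandt.XiSetup.exists_reindex` — `weight S'.O = weight S.O ∘ e⁻¹`,
  `matrix S'.O n = reindex e e (matrix S.O n)` for some `e : Cls S.O ≃ Cls S'.O`;
* `Brandt.XiSetup.comp_symm_mem_eigenLattice` — `v ∈ L_S(λ) → v ∘ e⁻¹ ∈ L_{S'}(λ)`;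
* `Brandt.XiSetup.atkinLehner_scalar_eq` — **if `T(q)` acts on `L_S(λ) ≠ 0` by `ε` and on
  `L_{S'}(λ)` by `ε'`, then `ε = ε'`** (any `q`, in fact any index `n`).

## References

* R. Pollack, T. Weston, Compos. Math. 147 (2011), §2.1 [PollackWeston2011].
* M.-F. Vignéras, LNM 800 (1980), Ch. III §5 exercice 5.8 [VignerasLNM800].
-/

noncomputable section

open scoped Matrix

namespace Literature.NumberTheory.Automorphic

namespace Brandt

variable {Nplus Nminus : ℕ}

/-- **The Brandt data of two setups of the same type differ by a reindexing** of the class sets: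
`weight S'.O = weight S.O ∘ e⁻¹` and `matrix S'.O n = reindex e e (matrix S.O n)`.
[cite: VignerasLNM800, Ch. III §5 B] -/
theorem XiSetup.exists_reindex (S S' : XiSetup Nplus Nminus) :
    ∃ e : ClassSet S.O ≃ ClassSet S'.O, weight S'.O = weight S.O ∘ e.symm ∧
      ∀ n, matrix S'.O n = Matrix.reindex e e (matrix S.O n) := by
  obtain ⟨e, hw, hT⟩ := S.exists_classSetEquiv S'
  refine ⟨e, funext fun a => ?_, fun n => ?_⟩
  · rw [Function.comp_apply, ← hw (e.symm a), Equiv.apply_symm_apply]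
  · ext a b
    rw [Matrix.reindex_apply, Matrix.submatrix_apply, ← hT n (e.symm a) (e.symm b),
      Equiv.apply_symm_apply, Equiv.apply_symm_apply]

/-- Reindexed matrices act on reindexed vectors: `(reindex e e M) (v ∘ e⁻¹) = (M v) ∘ e⁻¹`.
[folklore] -/
theorem reindex_mulVec_comp_symm {ι κ : Type*} [Fintype ι] [Fintype κ] (e : ι ≃ κ)
    (M : Matrix ι ι ℤ) (v : ι → ℤ) :
    Matrix.reindex e e M *ᵥ (v ∘ e.symm) = (M *ᵥ v) ∘ e.symm := by
  rw [Matrix.reindex_apply, Matrix.submatrix_mulVec_equiv]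
  congr 2
  ext i
  simp

/-- **Eigen-lattices of two setups correspond**: if `matrix S'.O n = reindex e e (matrix S.O n)`
for all `n`, then `v ∈ L_S(λ)` implies `v ∘ e⁻¹ ∈ L_{S'}(λ)`. [folklore] -/
theorem XiSetup.comp_symm_mem_eigenLattice (S S' : XiSetup Nplus Nminus) [Fintype (ClassSet S.O)]
    [Fintype (ClassSet S'.O)] (e : ClassSet S.O ≃ ClassSet S'.O)
    (hT : ∀ n, matrix S'.O n = Matrix.reindex e e (matrix S.O n)) {N : ℕ} {lam : ℕ → ℤ}
    {v : ClassSet S.O → ℤ} (hv : v ∈ eigenLattice N (matrix S.O) lam) :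
    v ∘ e.symm ∈ eigenLattice N (matrix S'.O) lam := by
  intro p hp hpN
  rw [hT p, reindex_mulVec_comp_symm, hv p hp hpN]
  ext a
  simp

/-- **The scalar by which `T(n)` acts on the `λ`-eigen-lattice does not depend on the setup**: if
`T(n)` acts on `L_S(λ) ≠ 0` by `ε` and on `L_{S'}(λ)` by `ε'` (e.g. the Atkin–Lehner signs at a
prime `q ∣ N⁻` of `Brandt.XiSetup.exists_atkinLehnerSign`), then `ε = ε'`. [cite: PollackWeston2011, §2.1] -/
theorem XiSetup.atkinLehner_scalar_eq (S S' : XiSetup Nplus Nminus) [Fintype (ClassSet S.O)]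
    [Fintype (ClassSet S'.O)] {n : ℕ} {lam : ℕ → ℤ} {ε ε' : ℤ}
    (hε : ∀ v ∈ eigenLattice (Nplus * Nminus) (matrix S.O) lam, matrix S.O n *ᵥ v = ε • v)
    (hε' : ∀ v ∈ eigenLattice (Nplus * Nminus) (matrix S'.O) lam, matrix S'.O n *ᵥ v = ε' • v)
    (hne : eigenLattice (Nplus * Nminus) (matrix S.O) lam ≠ ⊥) : ε = ε' := by
  obtain ⟨e, -, hT⟩ := S.exists_reindex S'
  obtain ⟨v, hv, hv0⟩ := Submodule.exists_mem_ne_zero_of_ne_bot hne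
  have h1 := hε' _ (S.comp_symm_mem_eigenLattice S' e hT hv)
  rw [hT n, reindex_mulVec_comp_symm, hε v hv] at h1
  -- `h1 : (ε • v) ∘ e⁻¹ = ε' • (v ∘ e⁻¹)`; evaluate at `e i` with `v i ≠ 0`
  obtain ⟨i, hi⟩ : ∃ i, v i ≠ 0 := by
    by_contra h
    push Not at h
    exact hv0 (funext h)
  have h2 := congrFun h1 (e i)
  simp only [Function.comp_apply, Pi.smul_apply, smul_eq_mul, Equiv.symm_apply_apply] at h2
  exact mul_right_cancel₀ hi h2

end Brandt

end Literature.NumberTheory.Automorphic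

end
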